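import Mathlib
import Summits.KontsevichZagierPeriods.Zeta5Search.Elimination.DictBridgeFaceLaw
import HarnessLib

/-!
# The level-`1` stratum of gen-1's bridge: three clusters (E-L22a; fam-elim gen 24)

HONEST FRAMING: systematic search; no irrationality claim unless certified — identities among the rational Taylor
data `U, V, W` of the Ball–Rivoal family and gen-1's dictionary values `(Q, P̂, P)`; nothing about sizes/irrationality.

OUR work (Summit side; `families/elim/FAMILY.md` §17).  After `Elimination/DictBridge` (interior),
`Elimination/DictBridgeFace` + `Elimination/DictBridgeFaceLaw` (the whole pair-sum boundary) the only open leaf of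
gen-1's GLOBAL node `DictBridge` is `Elimination/DictBridgeStrata.DictBridgeLevelOne` (level `c₀ ≤ 1`).  THIS FILE,
PROVED: the CLASSIFICATION of that stratum (`levelOne_cases`) — under the `RegionHyp`s of `c`, `c+e₇`, `Hc` a bridge
cluster of level `c₀ ≤ 1` has base `c = bOfA a ∈ {(1;0⁷), (1;0,1,0,0,0,0,0), (1;1,0,0,0,0,0,0)}` (the box of `c+e₇`
forces `c₀ = 1`, `c₇ = 0`; the box of `Hc` forces `c₄ = c₅ = 0`; the edge pairs `37, 67` of `c+e₇` force `c₃ = c₆ = 0`;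
the edge pair `12` of `c` forbids `c₁ = c₂ = 1`) — and the bookkeeping `dictBridgeLevelOne_of_clusters :
DictBridgeClusterOne → DictBridgeClusterTwo → DictBridgeClusterThree → DictBridgeLevelOne`,
`dictBridge_of_clusters : … → DictBridge`, where `DictBridgeCluster*` (`@[conjecture]`, OPEN) is gen-1's four-term
relation at ONE explicit cluster: three rows × one cluster = three identities among the `12` rational numbers
`casUW, casUV, casVW` at the four points `c, c+e₇, Hc, DSc` (exact values, e.g. at `c = (1;0⁷)`: `(U,W,V)(c) = (−8,−28,−42)`,
`(U,W,V)(c+e₇) = (2,10,14)`, `(U,W,V)(Hc) = (−2,−11/2,−139/16)`, `(U,W,V)(DSc) = (18,66,98)`; all partial-fraction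
tables (4–10 non-zero entries each) in `HOME/pub-zeta5-fam-elim/g24/tt/level1_pf.json`), verified EXACTLY outside Lean;
the in-Lean path is one explicit `IsPFData` certificate per point (gen-1's `WedgeDictionaryCorner` §4 pattern), `7`
points per cluster.
What this is NOT: no cluster node is proved here; nothing about sizes, denominators or irrationality; the class verdict
is unchanged (T1 NO / T2 NO / T4 YES).
-/

open Finset

namespace Summit.KontsevichZagierPeriods.Zeta5Search.Elimination

open Summit.KontsevichZagierPeriods.Zeta5Search.WedgeDictionary
open Literature.NumberTheory.Irrationality.BrownZudilin2022 (bOfA)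

/-! ### 1. The three cluster bases and the cluster nodes -/

/-- Cluster base `(1;0⁷)`. -/
def kOne : ℕ → ℤ := fun j => if j = 0 then 1 else 0

/-- Cluster base `(1;0,1,0,0,0,0,0)`. -/
def kTwo : ℕ → ℤ := fun j => if j = 0 ∨ j = 2 then 1 else 0

/-- Cluster base `(1;1,0,0,0,0,0,0)`. -/
def kThree : ℕ → ℤ := fun j => if j = 0 ∨ j = 1 then 1 else 0

/-- **gen-1's bridge at the cluster `(1;0⁷)` (node; OPEN — three rational identities among the `12` Casoratians of the
cluster, verified exactly outside Lean).** -/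
@[conjecture] def DictBridgeClusterOne : Prop :=
  ∀ (a : Fin 8 → ℤ) (j₀ j₁ j₂ j₃ : ℕ), (∀ j, j ≤ 7 → bOfA a j = kOne j) →
    RegionHyp a j₀ → RegionHyp (a - slotDown 7) j₁ → RegionHyp (a + halfUp457) j₂ → RegionHyp (a + dsUp) j₃ →
      DictFourTerm (bridgeBase (bOfA a)) (bridgeSlot (bOfA a)) (bridgeHalf (bOfA a)) (bridgeApex (bOfA a))
        a (a - slotDown 7) (a + halfUp457) (a + dsUp) j₀ j₁ j₂ j₃

/-- **gen-1's bridge at the cluster `(1;0,1,0,0,0,0,0)` (node; OPEN — verified exactly outside Lean).** -/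
@[conjecture] def DictBridgeClusterTwo : Prop :=
  ∀ (a : Fin 8 → ℤ) (j₀ j₁ j₂ j₃ : ℕ), (∀ j, j ≤ 7 → bOfA a j = kTwo j) →
    RegionHyp a j₀ → RegionHyp (a - slotDown 7) j₁ → RegionHyp (a + halfUp457) j₂ → RegionHyp (a + dsUp) j₃ →
      DictFourTerm (bridgeBase (bOfA a)) (bridgeSlot (bOfA a)) (bridgeHalf (bOfA a)) (bridgeApex (bOfA a))
        a (a - slotDown 7) (a + halfUp457) (a + dsUp) j₀ j₁ j₂ j₃

/-- **gen-1's bridge at the cluster `(1;1,0,0,0,0,0,0)` (node; OPEN — verified exactly outside Lean).** -/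
@[conjecture] def DictBridgeClusterThree : Prop :=
  ∀ (a : Fin 8 → ℤ) (j₀ j₁ j₂ j₃ : ℕ), (∀ j, j ≤ 7 → bOfA a j = kThree j) →
    RegionHyp a j₀ → RegionHyp (a - slotDown 7) j₁ → RegionHyp (a + halfUp457) j₂ → RegionHyp (a + dsUp) j₃ →
      DictFourTerm (bridgeBase (bOfA a)) (bridgeSlot (bOfA a)) (bridgeHalf (bOfA a)) (bridgeApex (bOfA a))
        a (a - slotDown 7) (a + halfUp457) (a + dsUp) j₀ j₁ j₂ j₃

/-! ### 2. Classification of the level-`1` stratum -/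

/-- **The level-`1` bridge clusters.**  Under the `RegionHyp`s at `a`, `a − s₇`, `a + h₄₅₇` and `bOfA a 0 ≤ 1` the base
`bOfA a` is one of the three cluster bases (on the slots `0…7`). -/
theorem levelOne_cases (a : Fin 8 → ℤ) (j₀ j₁ j₂ : ℕ) (hL : bOfA a 0 ≤ 1) (H₀ : RegionHyp a j₀)
    (H₁ : RegionHyp (a - slotDown 7) j₁) (H₂ : RegionHyp (a + halfUp457) j₂) :
    (∀ j, j ≤ 7 → bOfA a j = kOne j) ∨ (∀ j, j ≤ 7 → bOfA a j = kTwo j) ∨ (∀ j, j ≤ 7 → bOfA a j = kThree j) := by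
  obtain ⟨-, hconv, hreg, -, -⟩ := H₀
  obtain ⟨-, hconv1, hreg1, -, -⟩ := H₁
  obtain ⟨-, -, hreg2, -, -⟩ := H₂
  set c := bOfA a with hc
  have h7b : ∀ j, j ≤ 7 → bOfA (a - slotDown 7) j = bump c 6 j := fun j hj => by
    rw [bOfA_sub_slotDown7 a j hj]
    by_cases h : j = 7
    · rw [if_pos h, h, bump6_seven]
    · rw [if_neg h, bump_of_ne c (show j ≠ 6 + 1 by omega)]
  have hHb : ∀ j, j ≤ 7 → bOfA (a + halfUp457) j = hShift c j := fun j hj => by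
    rw [bOfA_add_halfUp457 a j hj]
    unfold hShift
    rfl
  have hcs : ∀ k, 1 ≤ k → k ≤ 7 → 0 ≤ c k ∧ 2 * c k ≤ c 0 + 1 := fun k h1 h7 => hreg k (mem_Icc.2 ⟨h1, h7⟩)
  have hc1 := hcs 1 (by norm_num) (by norm_num)
  have hc2 := hcs 2 (by norm_num) (by norm_num)
  have hc3 := hcs 3 (by norm_num) (by norm_num)
  have hc4 := hcs 4 (by norm_num) (by norm_num)
  have hc5 := hcs 5 (by norm_num) (by norm_num)
  have hc6 := hcs 6 (by norm_num) (by norm_num)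
  have hc7 := hcs 7 (by norm_num) (by norm_num)
  -- the box of `c + e₇` at slot `7`: `c₀ = 1`, `c₇ = 0`
  have hb7 := hreg1 7 (by simp)
  rw [h7b 7 (by norm_num), h7b 0 (by norm_num), bump6_seven, bump_zero] at hb7
  -- the box of `Hc` at slots `4, 5`: `c₄ = c₅ = 0`
  obtain ⟨v0, -, -, -, v4, v5, -, -⟩ := hShift_vals c
  have hb4 := hreg2 4 (by simp)
  have hb5 := hreg2 5 (by simp)
  rw [hHb 4 (by norm_num), hHb 0 (by norm_num), v4, v0] at hb4
  rw [hHb 5 (by norm_num), hHb 0 (by norm_num), v5, v0] at hb5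
  -- edge pairs at `c` and at `c + e₇`
  have hE := epairs_le_of_converges a hconv
  have e12 := hE (1, 2) (by decide)
  have hE1 := epairs_le_of_converges _ hconv1
  have e37 := hE1 (3, 7) (by decide)
  have e67 := hE1 (6, 7) (by decide)
  simp only at e12 e37 e67
  rw [← hc] at e12
  rw [h7b 3 (by norm_num), h7b 7 (by norm_num), h7b 0 (by norm_num), bump6_seven, bump_zero,
    bump_of_ne c (show (3 : ℕ) ≠ 6 + 1 by omega)] at e37
  rw [h7b 6 (by norm_num), h7b 7 (by norm_num), h7b 0 (by norm_num), bump6_seven, bump_zero,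
    bump_of_ne c (show (6 : ℕ) ≠ 6 + 1 by omega)] at e67
  have k0 : c 0 = 1 := by omega
  have k7 : c 7 = 0 := by omega
  have k4 : c 4 = 0 := by omega
  have k5 : c 5 = 0 := by omega
  have k3 : c 3 = 0 := by omega
  have k6 : c 6 = 0 := by omega
  rcases (show (c 1 = 0 ∧ c 2 = 0) ∨ (c 1 = 0 ∧ c 2 = 1) ∨ (c 1 = 1 ∧ c 2 = 0) by omega) with ⟨k1, k2⟩ | ⟨k1, k2⟩ | ⟨k1, k2⟩
  · refine Or.inl fun j hj => ?_
    interval_cases j <;> simp only [kOne] <;> norm_num <;> assumption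
  · refine Or.inr (Or.inl fun j hj => ?_)
    interval_cases j <;> simp only [kTwo] <;> norm_num <;> assumption
  · refine Or.inr (Or.inr fun j hj => ?_)
    interval_cases j <;> simp only [kThree] <;> norm_num <;> assumption

/-! ### 3. The level-`1` leaf from the three clusters -/

/-- **`DictBridgeLevelOne` from the three cluster nodes.** -/
theorem dictBridgeLevelOne_of_clusters (h1 : DictBridgeClusterOne) (h2 : DictBridgeClusterTwo)
    (h3 : DictBridgeClusterThree) : DictBridgeLevelOne := by
  intro a j₀ j₁ j₂ j₃ hL H₀ H₁ H₂ H₃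
  rcases levelOne_cases a j₀ j₁ j₂ hL H₀ H₁ H₂ with h | h | h
  · exact h1 a j₀ j₁ j₂ j₃ h H₀ H₁ H₂ H₃
  · exact h2 a j₀ j₁ j₂ j₃ h H₀ H₁ H₂ H₃
  · exact h3 a j₀ j₁ j₂ j₃ h H₀ H₁ H₂ H₃

/-- **gen-1's GLOBAL `DictBridge` from the three cluster nodes** (interior, face: PROVED in the tree / in
`Elimination/DictBridgeFaceLaw`). -/
theorem dictBridge_of_clusters (h1 : DictBridgeClusterOne) (h2 : DictBridgeClusterTwo)
    (h3 : DictBridgeClusterThree) : DictBridge :=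
  dictBridge_of_levelOne (dictBridgeLevelOne_of_clusters h1 h2 h3)

end Summit.KontsevichZagierPeriods.Zeta5Search.Elimination
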